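import Summits.ResolutionOfSingularities.ResolutionOfSingularities.Theorems.MaxContactCutFrobeniusDescent

/-!
# MaxContactCutFrobeniusDescentAsides — the route asides of node «FrobeniusDescent» unfolded and keyed BY NAME
(decomp-res writer g4; companion of `MaxContactCutFrobeniusDescent`, filed once the asides
`MaxContactCut.PrimDefectWalksDeep`, `MaxContactCut.DefectWalksOne`, `MaxContactCut.PrimWalks` exist on the route).
Every statement here is an `Iff.rfl` unfolding or a by-name
re-keying of a kernel of `MaxContactCutFrobeniusDescent`; 0 sorry. [folklore]
-/

namespace Summit.ResolutionOfSingularities.ResolutionOfSingularities.Theorems.MaxContactCutFrobeniusDescentAsides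

open MvPolynomial
open Literature.AlgebraicGeometry.Resolution
open Summit.ResolutionOfSingularities.ResolutionOfSingularities.Theses
open Summit.ResolutionOfSingularities.ResolutionOfSingularities.Theorems
open TightDefectClasses TightDefectStrongWalks FrobeniusDescentStates FrobeniusDescentClasses
open MaxContactCutFrobeniusDescent

/-! ## The asides unfolded -/

/-- `PrimDefectWalksDeep` is the re-located deep residual of the model. [folklore] -/
theorem primDefectWalksDeep_iff : MaxContactCut.PrimDefectWalksDeep ↔ PrimDefectWalksTerminateDeep := Iff.rfl

/-- `DefectWalksOne` is the `e = 1` model column. [folklore] -/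
theorem defectWalksOne_iff : MaxContactCut.DefectWalksOne ↔ DefectWalksTerminateOne := Iff.rfl

/-- `PrimWalks` is the primitive-heads piece. [folklore] -/
theorem primWalks_iff : MaxContactCut.PrimWalks ↔ PrimWalksTerminate := Iff.rfl

/-! ## The same edges at aside level -/

/-- **EXACT at aside level: 31770 ⟺ `PrimDefectWalksDeep ∧ DefectWalksOne`.** [folklore] -/
theorem defectWalksDeep_iff_asides :
    MaxContactCut.DefectWalksDeep ↔ MaxContactCut.PrimDefectWalksDeep ∧ MaxContactCut.DefectWalksOne :=
  defectWalksDeep_iff_prim_and_one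

/-- **31770 ⟺ `PrimWalks`** at aside level. [folklore] -/
theorem defectWalksDeep_iff_primWalks' : MaxContactCut.DefectWalksDeep ↔ MaxContactCut.PrimWalks :=
  defectWalksDeep_iff_primWalks

/-- Necessity, port-free: 31770 implies both new asides. [folklore] -/
theorem asides_of_defectWalksDeep (h : MaxContactCut.DefectWalksDeep) :
    MaxContactCut.PrimDefectWalksDeep ∧ MaxContactCut.DefectWalksOne ∧ MaxContactCut.PrimWalks :=
  ⟨(defectWalksDeep_iff_asides.mp h).1, (defectWalksDeep_iff_asides.mp h).2, defectWalksDeep_iff_primWalks'.mp h⟩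

/-- **31770 from the residual aside, modulo CP2019 Thm 1.5 (i) and the two ports.** [folklore] -/
theorem defectWalksDeep_of_primDefectWalksDeep
    (hCP : Literature.AlgebraicGeometry.Resolution.CossartPiltant2019LocalPermissible.{0}) (hV : ShallowColumnPort)
    (hR : ShallowRealisation) (hP : MaxContactCut.PrimDefectWalksDeep) : MaxContactCut.DefectWalksDeep :=
  defectWalksDeep_of_prim_cp hCP hV hR hP

/-- **`DefectWalksOne` from CP2019 Thm 1.5 (i) and the two ports** (KNOWN-MOD-PORT). [folklore] -/
theorem defectWalksOne_of_cp (hCP : Literature.AlgebraicGeometry.Resolution.CossartPiltant2019LocalPermissible.{0})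
    (hV : ShallowColumnPort) (hR : ShallowRealisation) : MaxContactCut.DefectWalksOne :=
  defectOne_of_cp hCP hV hR

/-- **31769 `PolyPureTowersDeep` from the residual aside** modulo the dictionary port, CP2019 and the two ports. [folklore] -/
theorem polyPureTowersDeep_of_primDefectWalksDeep
    (hCP : Literature.AlgebraicGeometry.Resolution.CossartPiltant2019LocalPermissible.{0}) (hV : ShallowColumnPort)
    (hR : ShallowRealisation) (hT : TowerDictionary) (hP : MaxContactCut.PrimDefectWalksDeep) :
    MaxContactCut.PolyPureTowersDeep :=
  MaxContactCutTightDefect.polyPureTowersDeep_of_defectWalksDeep hT (defectWalksDeep_of_prim_cp hCP hV hR hP)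

/-- Necessity from 30253 at aside level (mod the tree's realisation port). [folklore] -/
theorem asides_of_noForcedTowers (hR : TowerRealisation) (h : MaxContactCut.NoForcedTowers) :
    MaxContactCut.PrimWalks ∧ MaxContactCut.PrimDefectWalksDeep ∧ MaxContactCut.DefectWalksOne :=
  pieces_of_noForcedTowers hR h

end Summit.ResolutionOfSingularities.ResolutionOfSingularities.Theorems.MaxContactCutFrobeniusDescentAsides
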